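import Summits.QuantumFields.YangMills.Theorems.UV3BranchExpansionStackedActivity
import Summits.QuantumFields.YangMills.Theorems.BalabanUVNodesN08HaarCompatibilityGuardCoreLawSU2Record
import Summits.QuantumFields.YangMills.Theorems.BalabanUVNodesN08HaarCompatibilityGuardAdmitting
import Summits.QuantumFields.YangMills.Theorems.BalabanUVNodesN08HaarCompatibilityGuardKStepMasses

/-!
# BalabanUVNodes ∕ N08 — DISCHARGE OF THE TWO NUMERIC BINDERS OF THE BRANCH EXPANSION'S STACKED ACTIVITY (w8 ✓`UV3BranchExpansionStackedActivity.map_restrict_traj_le_pow_smul`):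
# the per-level ADMITTING BOUND `q` (from n08-w3 ✓`measure_forall_guardAdmitting_le`, any group) and (H_K) at the [B10] slot `N = 2` in the record range (n08-w6
# ✓`fibre_law_le_su2_record`) ⇒ the stacked activity `≤ Π_n K_rec^{|s′ n|}·q(δ′)^{|s n|} • dU_{j+N}` with EXPLICIT `K_rec = m⋆⁻¹ + 1`, `q(δ′) = h(1∕3+δ′)^{L^{d−1}−1} ∕ h(δ′)`

Track A, DAG node N08 ([Balaban1985UV3] Thm 1 p. 257 ∕ Thm 2 p. 272; averaging [Balaban1987RG1] (0.4) p. 253).  Cell `pub-ymgap`, seat `pub-ymgap-dag-n08-d` g47 (R529-ym job; px8 g13's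
«YOUR BEST SWITCH: the hw-side», 04:34:57Z); ledger key `--supports stmt-QuantumFields-27364 --as helper` («cc 19936 (O‴χₛ) supply», director №326).  Composition BY NAME of w8's (F-TOP-hw)
letter with the N08 lineage's one-bond facts; nothing new is estimated here.

CONTENTS ([folklore] bookkeeping; 0 `def`, 0 `sorry`): §1 (any group) `pow_div_pow_eq`, ★★ `measure_guardAdmitting_le_pow` — `dU_j{∀ c ∈ S, ∃ g, Small ℰ (U[β c ↦ g]) c} ≤ (h(δ+δ′)^{L^{d−1}−1} ∕ h(δ′))^{|S|}`
for every `δ′` with `h(δ′) := Haar{dist1 < δ′} ≠ 0`; §2 (`SU(2)`, `ℰ = expMeanLogSU`, `L^{d−1} ≤ 400`) ★★★ `map_restrict_traj_le_pow_smul_su2_record` — w8's stacked activity with BOTH binders discharged.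
HONEST: count-neutral helper; the weights `w s` of LEAD's socket follow by w8's letter; the COUNT (C′), (M) and the assembly of hTop are the ym3-torus lane's; hTop ∕ hJ NOT proved here;
N08 NOT discharged; R3 ≠ d = 4 ∕ mass gap ∕ Clay.
-/

noncomputable section

open MeasureTheory Function
open scoped ENNReal

namespace Summit.QuantumFields.YangMills.Theorems.BalabanUVNodesN08SocketWeightsDischarge

open Literature.MathematicalPhysics.QuantumFieldTheory.Balaban1983to89
open Literature.MathematicalPhysics.QuantumFieldTheory.Balaban1983to89.T4Continuum
open Literature.MathematicalPhysics.QuantumFieldTheory.Balaban1983to89.AveragingRT (axialAvg)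
open Literature.MathematicalPhysics.QuantumFieldTheory.Balaban1983to89.BlockAveraging (Small avgFun)
open Literature.MathematicalPhysics.QuantumFieldTheory.Balaban1983to89.BlockAveragingHaarAC (centralBond)
open Literature.MathematicalPhysics.QuantumFieldTheory.Balaban1983to89.ExpMeanLog (expMeanLogSU measurable_expMeanLogSU_E)
open Summit.QuantumFields.YangMills.BalabanUVNodes.N08HaarCompatibilityGuardAdmitting (measure_forall_guardAdmitting_le)
open Summit.QuantumFields.YangMills.BalabanUVNodes.N08HaarCompatibilityGuardCoreLawSU2Record (fibre_law_le_su2_record card_not_central_div_le_record mstar_record_pos)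
open Summit.QuantumFields.YangMills.BalabanUVNodes.N08HaarCompatibilityGuardKStepMasses (haar_dist1_lt_ne_zero)
open Summit.QuantumFields.YangMills.Theorems.UV3BranchExpansionStackedActivity (map_restrict_traj_le_pow_smul)

/-! ## §1 The admitting bound `q`, any group -/

/-- `b^{n·k} ∕ a^n = (b^k ∕ a)^n` in `ℝ≥0∞`. [folklore] -/
theorem pow_div_pow_eq (a b : ℝ≥0∞) (k n : ℕ) : b ^ (n * k) / a ^ n = (b ^ k / a) ^ n := by
  rw [div_eq_mul_inv, div_eq_mul_inv, mul_pow, ENNReal.inv_pow, pow_mul, ← pow_mul, ← pow_mul, mul_comm k n]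

variable {P : Params} {j : ℕ} {G : Type*} [GaugeGroup G] [MeasurableSpace G] [RegularGaugeGroup G] [HaarData G]

/-- ★★ **THE ADMITTING BOUND**: for every `δ′` with `h(δ′) := Haar{dist1 < δ′} ≠ 0` and every finite set `S` of coarse bonds,
`dU_j {U | ∀ c ∈ S, ∃ g, Small ℰ (U[β c ↦ g]) c} ≤ (Haar{dist1 < ℰ.δ + δ′}^{L^{d−1}−1} ∕ h(δ′))^{|S|}` — n08-w3's ✓`measure_forall_guardAdmitting_le` divided through.  This is the binder `hq` of
w8's ✓`map_restrict_traj_le_pow_smul` with `q := Haar{dist1 < δ+δ′}^{L^{d−1}−1} ∕ h(δ′)`. [cite: Balaban1987RG1, (0.4) p.253 (bookkeeping)] -/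
theorem measure_guardAdmitting_le_pow (ℰ : LoopAverage G) (hj : j + 1 ≤ P.m + P.K) {δ' : ℝ}
    (hpos : (HaarData.haar : Measure G) {g : G | dist1 g < δ'} ≠ 0) (S : Finset (PBond P (j + 1))) :
    fieldMeasure P j G {U : GaugeField P j G | ∀ c ∈ S, ∃ g : G, Small ℰ (update U (centralBond c) g) c} ≤
      ((HaarData.haar : Measure G) {g : G | dist1 g < ℰ.δ + δ'} ^ (P.L ^ (P.d - 1) - 1) / (HaarData.haar : Measure G) {g : G | dist1 g < δ'}) ^ S.card := by
  haveI : IsProbabilityMeasure (HaarData.haar : Measure G) := HaarData.isProb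
  have h := measure_forall_guardAdmitting_le ℰ hj δ' S
  have ha0 : (HaarData.haar : Measure G) {g : G | dist1 g < δ'} ^ S.card ≠ 0 := pow_ne_zero _ hpos
  have hatop : (HaarData.haar : Measure G) {g : G | dist1 g < δ'} ^ S.card ≠ ∞ := ENNReal.pow_ne_top (measure_ne_top _ _)
  rw [← pow_div_pow_eq, ENNReal.le_div_iff_mul_le (Or.inl ha0) (Or.inl hatop), mul_comm]
  exact h

/-! ## §2 At the [B10] slot `N = 2`, record range `L^{d−1} ≤ 400`: both binders discharged -/

/-- ★★★ **w8's STACKED ACTIVITY WITH (H_K) AND THE ADMITTING BOUND DISCHARGED** (`SU(2)`, `ℰ = expMeanLogSU`, `δ = 1∕3`, record range `L^{d−1} ≤ 400`): for every history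
`(s, s′)` with `s′ n ⊆ s n`, its hybrid trajectory `V`, every `N` in the standing range and every `δ′ > 0`,
`((dU_j)↾{∀ n<N, ∀ c ∈ s n, Small (V n U) c}).map (V N) ≤ (Π_{n<N} K_rec^{|s′ n|} · q(δ′)^{|s n|}) • dU_{j+N}`, `K_rec = m⋆_rec⁻¹ + 1` (n08-w6 ✓`fibre_law_le_su2_record`),
`q(δ′) = Haar{dist1 < 1∕3 + δ′}^{L^{d−1}−1} ∕ Haar{dist1 < δ′}` (§1).  The sets `s′ n` beyond the standing range must be empty (`hsr`). [cite: Balaban1987RG1, (0.4) p.253; Balaban1985UV3, (2) p.256] -/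
theorem map_restrict_traj_le_pow_smul_su2_record (N : ℕ) (hN : j + N ≤ P.m + P.K) (hL : P.L ^ (P.d - 1) ≤ 400)
    (s s' : (n : ℕ) → Finset (PBond P (j + n + 1))) (hs' : ∀ n, s' n ⊆ s n) (hsr : ∀ n, (s' n).Nonempty → j + n + 1 ≤ P.m + P.K)
    (V : (n : ℕ) → GaugeField P j (Matrix.specialUnitaryGroup (Fin 2) ℂ) → GaugeField P (j + n) (Matrix.specialUnitaryGroup (Fin 2) ℂ)) (hV0 : ∀ U, V 0 U = U)
    (hVs : ∀ n U, V (n + 1) U = (fun c => if c ∈ s' n then avgFun (expMeanLogSU : LoopAverage (Matrix.specialUnitaryGroup (Fin 2) ℂ)) (V n U) c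
      else axialAvg (V n U) c : GaugeField P (j + n + 1) (Matrix.specialUnitaryGroup (Fin 2) ℂ)))
    {δ' : ℝ} (hδ' : 0 < δ') :
    ((fieldMeasure P j (Matrix.specialUnitaryGroup (Fin 2) ℂ)).restrict
        {U | ∀ n < N, ∀ c ∈ s n, Small (expMeanLogSU : LoopAverage (Matrix.specialUnitaryGroup (Fin 2) ℂ)) (V n U) c}).map (V N) ≤
      (∏ n ∈ Finset.range N,
          (((ENNReal.ofReal (((1 / 400 : ℝ) * Real.sin 1 * (Real.sin (Real.pi / 3) / (Real.pi / 3))) ^ 3 * (Real.sin (Real.pi / 3) / (Real.pi / 3)) ^ 2))⁻¹ + 1) ^ (s' n).card *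
          ((HaarData.haar : Measure (Matrix.specialUnitaryGroup (Fin 2) ℂ)) {g | dist1 g < (expMeanLogSU : LoopAverage (Matrix.specialUnitaryGroup (Fin 2) ℂ)).δ + δ'} ^ (P.L ^ (P.d - 1) - 1) /
            (HaarData.haar : Measure (Matrix.specialUnitaryGroup (Fin 2) ℂ)) {g | dist1 g < δ'}) ^ (s n).card)) •
        fieldMeasure P (j + N) (Matrix.specialUnitaryGroup (Fin 2) ℂ) := by
  refine map_restrict_traj_le_pow_smul (expMeanLogSU : LoopAverage (Matrix.specialUnitaryGroup (Fin 2) ℂ)) measurable_expMeanLogSU_E N hN s s' hs' V hV0 hVs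
    le_add_self (ENNReal.add_ne_top.2 ⟨ENNReal.inv_ne_top.2 (ENNReal.ofReal_pos.2 mstar_record_pos).ne', ENNReal.one_ne_top⟩) ?_ _ ?_
  · -- (H_K) per level, n08-w6's record-range fibre law
    intro n c hc U hU
    exact fibre_law_le_su2_record (hsr n ⟨c, hc⟩) (fun c' => card_not_central_div_le_record c' hL) c U hU
  · -- the admitting bound per level, §1
    intro n hn S
    exact measure_guardAdmitting_le_pow (expMeanLogSU : LoopAverage (Matrix.specialUnitaryGroup (Fin 2) ℂ)) (by omega) (haar_dist1_lt_ne_zero 2 hδ') S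

end Summit.QuantumFields.YangMills.Theorems.BalabanUVNodesN08SocketWeightsDischarge

end
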